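import Summits.Ventures.YMGap.RobustBall.TermPerturbation
import Summits.Ventures.YMGap.RobustBall.RectangleCode
import HarnessLib

/-!
# RobustBall/PlaquetteCode — the plaquette word, its 3-site polymer, and the direction-pair counts
(cell `pub-ymgap`, track Y2 ROBUST-BALL, plaquette rung T0.6; ds-4 — plaquette-word block by p1)

HONEST FRAMING: finite-torus combinatorics only (no probability, no continuum, no Clay claim).

* The PLAQUETTE WORD of `(x; i, j)`: the four letters `(x,i)⁺ (x+e_i,j)⁺ (x+e_j,i)⁻ (x,j)⁻`; its holonomy is the tree's
  `plaquetteHolonomy U x i j`; it is a closed walk at `x`; it is balanced (`netCount = 0`, `i ≠ j`); its link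
  multiplicities letter by letter and summed over base points (`2[i = e.2] + 2[j = e.2]`).
* The PLAQUETTE POLYMER `plaqCode x i j = {x, x+e_i, x+e_j}` (base points of the four links): every letter is based
  in it; its links are the tree's `plaqEdgesT`; all letters of one direction sit at ONE height (vertical window `1`);
  `torusNorm`-diameter `≤ 1`; for `3 ≤ L` the polymer DETERMINES `(x, i, j)` on `i < j` (`plaqCode_injective`); at
  most `3` base points put a given site into `plaqCode · i j`.
* DIRECTION-PAIR COUNTS over `LtPair d = {(i, j) : i < j}` (the second factor of the tree's `Plaquette d L`):
  `Σ [i = k] + [j = k] = d − 1` and `2 · #LtPair = d(d − 1)`.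
-/

noncomputable section

open Finset Function
open Literature.MathematicalPhysics.QuantumLattice hiding torusNorm
open Literature.MathematicalPhysics.QuantumFieldTheory hiding ZdEdge

namespace Summit.Ventures.YMGap.RobustBall

variable {d L N : ℕ}

/-!
### The plaquette word (shared with p1's parallel-pair witness)

The block `plaqWord` … `sum_mult_plaqWord_add` below is p1's (cell `pub-ymgap`, HOME/lean/witness/ParallelPairCode.lean,
2026-08-22), hosted here so that both the plaquette member (ds-4) and the parallel-pair witness (p1) import ONE copy.
-/

/-- The four letters of the plaquette `(x; i, j)`: `(x,i)⁺ (x+e_i,j)⁺ (x+e_j,i)⁻ (x,j)⁻`. [folklore] -/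
def plaqWord (x : Site d L) (i j : Fin d) : List (Letter d L) :=
  [⟨x, i, false⟩, ⟨x + unitVec i, j, false⟩, ⟨x + unitVec j, i, true⟩, ⟨x, j, true⟩]

/-- **The word holonomy is the tree's plaquette holonomy.** [folklore] -/
theorem wordProd_plaqWord {G : Type*} [Group G] (U : GaugeConfig d L G) (x : Site d L) (i j : Fin d) :
    wordProd (plaqWord x i j) U = plaquetteHolonomy U x i j := by
  simp only [plaqWord, wordProd_cons, wordProd_nil, Letter.hol, Letter.edge, Bool.false_eq_true, if_false, if_true,
    plaquetteHolonomy, Literature.MathematicalPhysics.QuantumFieldTheory.Site.shift, unitVec, mul_one, mul_assoc]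

/-- The plaquette word is a closed walk based at `x`. [folklore] -/
theorem isWalk_plaqWord (x : Site d L) (i j : Fin d) : IsWalk x (plaqWord x i j) x := by
  simp [plaqWord, IsWalk, Letter.src, Letter.tgt, Literature.MathematicalPhysics.QuantumFieldTheory.Site.shift, unitVec,
    add_comm, add_left_comm]

/-- **Balance** of the plaquette word (`i ≠ j`). [folklore] -/
theorem netCount_plaqWord {x : Site d L} {i j : Fin d} (hij : i ≠ j) (v : Fin d) (t : ZMod L) :
    netCount (plaqWord x i j) v t = 0 := by
  simp only [netCount, plaqWord, List.map_cons, List.map_nil, List.sum_cons, List.sum_nil, Bool.false_eq_true,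
    if_false, if_true, add_zero]
  by_cases hvi : i = v
  · subst hvi
    simp only [true_and, hij.symm, false_and, if_false, add_zero, Pi.add_apply, unitVec_apply_of_ne hij]
    split_ifs <;> norm_num
  · by_cases hvj : j = v
    · subst hvj
      simp only [true_and, hvi, false_and, if_false, zero_add, add_zero, Pi.add_apply,
        unitVec_apply_of_ne (Ne.symm hij)]
      split_ifs <;> norm_num
    · simp [hvi, hvj]

/-- `Re tr` of the reversed plaquette equals `Re tr` of the plaquette (`U_{(x;j,i)} = U_{(x;i,j)}⁻¹`). [folklore] -/
theorem re_trace_plaquetteHolonomy_swap (U : GaugeConfig d L (SUN N)) (x : Site d L) (i j : Fin d) :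
    ((plaquetteHolonomy U x j i : SUN N) : Matrix (Fin N) (Fin N) ℂ).trace.re =
      ((plaquetteHolonomy U x i j : SUN N) : Matrix (Fin N) (Fin N) ℂ).trace.re := by
  have h : plaquetteHolonomy U x j i = (plaquetteHolonomy U x i j)⁻¹ := by
    simp only [plaquetteHolonomy, mul_inv_rev, inv_inv, mul_assoc]
  rw [h, su_coe_inv, Matrix.trace_conjTranspose, Complex.star_def, Complex.conj_re]

/-- The multiplicity of a link in the plaquette word, letter by letter (in the order produced by `mult_cons`).
[folklore] -/
theorem mult_plaqWord (x : Site d L) (i j : Fin d) (e : Edge d L) :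
    mult (plaqWord x i j) e =
      (if (x, j) = e then 1 else 0) + (if (x + unitVec j, i) = e then 1 else 0) +
        (if (x + unitVec i, j) = e then 1 else 0) + (if (x, i) = e then 1 else 0) := by
  simp only [plaqWord, mult_cons, mult_nil, Letter.edge, zero_add]
  split_ifs <;> rfl

/-- **Letters of a plaquette through a link, summed over base points**: `Σ_x mult_{plaqWord x i j}(e) =
2[i = e.2] + 2[j = e.2]`. [folklore] -/
theorem sum_mult_plaqWord [NeZero L] (i j : Fin d) (e : Edge d L) :
    ∑ x : Site d L, mult (plaqWord x i j) e = 2 * (if i = e.2 then 1 else 0) + 2 * (if j = e.2 then 1 else 0) := by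
  simp only [mult_plaqWord, sum_add_distrib, sum_ite_site_eq, sum_ite_translate_eq]
  ring

/-- Translating the base point does not change the summed multiplicity. [folklore] -/
theorem sum_mult_plaqWord_add [NeZero L] (u : Site d L) (i j : Fin d) (e : Edge d L) :
    ∑ x : Site d L, mult (plaqWord (x + u) i j) e = ∑ x : Site d L, mult (plaqWord x i j) e :=
  Fintype.sum_equiv (Equiv.addRight u) _ _ fun _ => rfl

/-! ### The plaquette polymer (3-site code) -/

/-- The plaquette word has four letters. [folklore] -/
@[simp] theorem length_plaqWord (x : Site d L) (i j : Fin d) : (plaqWord x i j).length = 4 := rfl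

/-- The polymer of the plaquette `(x; i, j)`: the three base sites `{x, x+e_i, x+e_j}` of its links. [folklore] -/
def plaqCode (x : Site d L) (i j : Fin d) : Finset (Site d L) :=
  {x, x + unitVec i, x + unitVec j}

/-- Every letter of the plaquette word is based in the plaquette polymer. [folklore] -/
theorem site_mem_plaqCode {x : Site d L} {i j : Fin d} {l : Letter d L} (hl : l ∈ plaqWord x i j) :
    l.site ∈ plaqCode x i j := by
  simp only [plaqWord, List.mem_cons, List.mem_nil_iff, or_false] at hl
  rcases hl with rfl | rfl | rfl | rfl <;> simp [plaqCode]

/-- The links of the plaquette word are the tree's four plaquette edges `plaqEdgesT`. [folklore] -/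
theorem wordEdges_plaqWord_subset (q : Plaquette d L) :
    (↑(wordEdges (plaqWord q.1 q.2.1.1 q.2.1.2)) : Set (Edge d L)) ⊆ ↑(plaqEdgesT q) := by
  intro e he
  obtain ⟨l, hl, rfl⟩ := mem_wordEdges.1 (Finset.mem_coe.1 he)
  simp only [plaqWord, List.mem_cons, List.mem_nil_iff, or_false] at hl
  rcases hl with rfl | rfl | rfl | rfl <;>
    simp [plaqEdgesT, Letter.edge, Literature.MathematicalPhysics.QuantumFieldTheory.Site.shift, unitVec]

/-- **Vertical window `1`**: all letters of one direction sit at ONE height of that direction (`i ≠ j`). [folklore] -/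
theorem window_plaqWord {x : Site d L} {i j : Fin d} (hij : i ≠ j) (v : Fin d) :
    ∃ t₀ : ZMod L, ∀ l ∈ plaqWord x i j, l.dir = v → ∃ k : ℕ, k < 1 ∧ l.site v = t₀ + k := by
  refine ⟨x v, fun l hl hlv => ⟨0, Nat.zero_lt_one, ?_⟩⟩
  simp only [plaqWord, List.mem_cons, List.mem_nil_iff, or_false] at hl
  rcases hl with rfl | rfl | rfl | rfl
  · simp
  · simp only at hlv
    subst hlv
    simp [unitVec_apply_of_ne (Ne.symm hij)]
  · simp only at hlv
    subst hlv
    simp [unitVec_apply_of_ne hij]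
  · simp

/-- Every point of the plaquette polymer is `x + a e_i + b e_j` with `a, b ≤ 1`. [folklore] -/
theorem exists_offsets_of_mem_plaqCode {x : Site d L} {i j : Fin d} {p : Site d L} (hp : p ∈ plaqCode x i j) :
    ∃ a b : ℕ, a ≤ 1 ∧ b ≤ 1 ∧ p = x + (Pi.single i (a : ZMod L) + Pi.single j (b : ZMod L)) := by
  simp only [plaqCode, mem_insert, mem_singleton] at hp
  rcases hp with rfl | rfl | rfl
  · exact ⟨0, 0, by norm_num, by norm_num, by simp⟩
  · exact ⟨1, 0, by norm_num, by norm_num, by simp [unitVec]⟩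
  · exact ⟨0, 1, by norm_num, by norm_num, by simp [unitVec]⟩

/-- **The plaquette polymer has periodic sup-diameter `≤ 1`** (`i ≠ j`). [folklore] -/
theorem polymerDiam_plaqCode_le {x : Site d L} {i j : Fin d} (hij : i ≠ j) : polymerDiam (plaqCode x i j) ≤ 1 := by
  refine Finset.sup_le fun p hp => Finset.sup_le fun q hq => ?_
  obtain ⟨a, b, ha, hb, rfl⟩ := exists_offsets_of_mem_plaqCode hp
  obtain ⟨a', b', ha', hb', rfl⟩ := exists_offsets_of_mem_plaqCode hq
  have hsub : x + (Pi.single i ((a : ℕ) : ZMod L) + Pi.single j ((b : ℕ) : ZMod L)) -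
      (x + (Pi.single i ((a' : ℕ) : ZMod L) + Pi.single j ((b' : ℕ) : ZMod L))) =
      (Pi.single i (((a : ℤ) - a' : ℤ) : ZMod L) : Site d L) + Pi.single j (((b : ℤ) - b' : ℤ) : ZMod L) := by
    simp only [Int.cast_sub, Int.cast_natCast, Pi.single_sub]
    abel
  rw [hsub]
  refine (torusNorm_single_add_single_le hij _ _).trans (max_le ?_ ?_) <;> omega

/-- **The polymer determines the plaquette** for torus side `L ≥ 3`: `plaqCode x i j = plaqCode x' i' j'` with
`i < j`, `i' < j'` forces `(x, i, j) = (x', i', j')`. [folklore] -/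
theorem plaqCode_injective (hL : 3 ≤ L) {x x' : Site d L} {i j i' j' : Fin d} (hij : i < j) (hij' : i' < j')
    (h : plaqCode x i j = plaqCode x' i' j') : x = x' ∧ i = i' ∧ j = j' := by
  have h1 : (1 : ZMod L) ≠ 0 := one_ne_zero_of_three_le hL
  have h2 : (2 : ZMod L) ≠ 0 := two_ne_zero_of_three_le hL
  -- unit vectors are nonzero, never sum to zero, and determine their direction
  have hu : ∀ k : Fin d, (unitVec k : Site d L) ≠ 0 := fun k hk =>
    h1 (by simpa [unitVec] using congrFun hk k)
  have huu : ∀ k k' : Fin d, (unitVec k : Site d L) + unitVec k' ≠ 0 := by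
    intro k k' hk
    have hkk' := congrFun hk k
    by_cases hkk : k' = k
    · subst hkk
      simp only [Pi.add_apply, unitVec_apply_self, Pi.zero_apply] at hkk'
      exact h2 (by linear_combination hkk')
    · simp only [Pi.add_apply, unitVec_apply_self, unitVec_apply_of_ne (Ne.symm hkk), add_zero, Pi.zero_apply] at hkk'
      exact h1 hkk'
  have hinj : ∀ {k k' : Fin d}, (unitVec k : Site d L) = unitVec k' → k = k' := by
    intro k k' hk
    by_contra hne
    have hkk' := congrFun hk k'
    rw [unitVec_apply_of_ne (Ne.symm hne), unitVec_apply_self] at hkk'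
    exact h1 hkk'.symm
  -- the base points agree
  have hx' : x' ∈ plaqCode x i j := by rw [h]; simp [plaqCode]
  have hx : x ∈ plaqCode x' i' j' := by rw [← h]; simp [plaqCode]
  have hxx : x = x' := by
    simp only [plaqCode, mem_insert, mem_singleton] at hx hx'
    rcases hx with h0 | h0 | h0
    · exact h0
    all_goals
      rcases hx' with h3 | h3 | h3
      · exact h3.symm
      all_goals
        exfalso
        rw [h3, add_assoc] at h0
        rw [eq_comm, add_eq_left] at h0
        exact huu _ _ h0
  subst hxx
  -- the direction pairs agree
  have hi : x + unitVec i ∈ plaqCode x i' j' := by rw [← h]; simp [plaqCode]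
  have hj : x + unitVec j ∈ plaqCode x i' j' := by rw [← h]; simp [plaqCode]
  simp only [plaqCode, mem_insert, mem_singleton, add_eq_left, add_right_inj] at hi hj
  rcases hi with hi | hi | hi
  · exact absurd hi (hu i)
  · rcases hj with hj | hj | hj
    · exact absurd hj (hu j)
    · exact absurd ((hinj hi).trans (hinj hj).symm) hij.ne
    · exact ⟨rfl, hinj hi, hinj hj⟩
  · rcases hj with hj | hj | hj
    · exact absurd hj (hu j)
    · rw [hinj hi, hinj hj] at hij
      exact absurd hij (lt_asymm hij')
    · exact absurd ((hinj hi).trans (hinj hj).symm) hij.ne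

/-! ### Counting over the plaquette directions `i < j` -/

/-- The index set of plaquette direction pairs `i < j` (the second factor of the tree's `Plaquette d L`). [folklore] -/
abbrev LtPair (d : ℕ) : Type := {p : Fin d × Fin d // p.1 < p.2}

/-- `Σ_{(i<j)} [i = k] = #{j : k < j} = d − 1 − k`. [folklore] -/
theorem sum_ltPair_ite_fst_eq (k : Fin d) : ∑ p : LtPair d, (if p.1.1 = k then (1 : ℕ) else 0) = d - 1 - k := by
  have e : {p : LtPair d // p.1.1 = k} ≃ {j : Fin d // k < j} :=
    { toFun := fun p => ⟨p.1.1.2, p.2.symm.trans_lt p.1.2⟩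
      invFun := fun j => ⟨⟨(k, j.1), j.2⟩, rfl⟩
      left_inv := fun ⟨⟨⟨a, b⟩, hab⟩, ha⟩ => by subst ha; rfl
      right_inv := fun _ => rfl }
  rw [Finset.sum_boole, Nat.cast_id, ← Fintype.card_subtype, Fintype.card_congr e, Fintype.card_subtype,
    Finset.filter_lt_eq_Ioi, Fin.card_Ioi]

/-- `Σ_{(i<j)} [j = k] = #{i : i < k} = k`. [folklore] -/
theorem sum_ltPair_ite_snd_eq (k : Fin d) : ∑ p : LtPair d, (if p.1.2 = k then (1 : ℕ) else 0) = k := by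
  have e : {p : LtPair d // p.1.2 = k} ≃ {i : Fin d // i < k} :=
    { toFun := fun p => ⟨p.1.1.1, p.1.2.trans_eq p.2⟩
      invFun := fun i => ⟨⟨(i.1, k), i.2⟩, rfl⟩
      left_inv := fun ⟨⟨⟨a, b⟩, hab⟩, hb⟩ => by subst hb; rfl
      right_inv := fun _ => rfl }
  rw [Finset.sum_boole, Nat.cast_id, ← Fintype.card_subtype, Fintype.card_congr e, Fintype.card_subtype,
    Finset.filter_gt_eq_Iio, Fin.card_Iio]

/-- **Direction count**: the number of plaquette direction pairs `i < j` containing `k` is `d − 1`. [folklore] -/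
theorem sum_ltPair_ite_eq (k : Fin d) :
    ∑ p : LtPair d, ((if p.1.1 = k then (1 : ℕ) else 0) + (if p.1.2 = k then 1 else 0)) = d - 1 := by
  have hk := k.2
  rw [sum_add_distrib, sum_ltPair_ite_fst_eq, sum_ltPair_ite_snd_eq]
  omega

/-- `2 · #{(i, j) : i < j} = d(d − 1)`. [folklore] -/
theorem two_mul_card_ltPair : 2 * Fintype.card (LtPair d) = d * (d - 1) := by
  have hswap : (univ.filter fun p : Fin d × Fin d => p.2 < p.1).card =
      (univ.filter fun p : Fin d × Fin d => p.1 < p.2).card := by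
    refine Finset.card_bij (fun p _ => (p.2, p.1)) (fun p hp => by simpa using hp) (fun p₁ _ p₂ _ hp => ?_)
      (fun p hp => ⟨(p.2, p.1), by simpa using hp, rfl⟩)
    simp only [Prod.mk.injEq] at hp
    exact Prod.ext hp.2 hp.1
  have hdisj : Disjoint (univ.filter fun p : Fin d × Fin d => p.1 < p.2)
      (univ.filter fun p : Fin d × Fin d => p.2 < p.1) :=
    Finset.disjoint_filter.2 fun p _ hp hq => lt_asymm hp hq
  have hunion : (univ.filter fun p : Fin d × Fin d => p.1 < p.2) ∪ (univ.filter fun p : Fin d × Fin d => p.2 < p.1) =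
      (univ : Finset (Fin d)).offDiag := by
    ext p
    simp only [mem_union, mem_filter, mem_univ, true_and, mem_offDiag]
    exact lt_or_lt_iff_ne
  have hcard := card_union_of_disjoint hdisj
  rw [hunion, Finset.offDiag_card, card_univ, Fintype.card_fin, hswap] at hcard
  rw [Fintype.card_subtype, Nat.mul_sub_one]
  omega

end Summit.Ventures.YMGap.RobustBall

end
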